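/-
COR-CM (cell pub-hodgecm2 = stage 2 of the Hodge ladder), seat b26 gen 16 (prover-pub-hodgecm2-b26-g16-0, 2026-08-21);
count-neutral for the binder table (no row).  The abelian-variety reading of
`Geometry/WeightOneHodgeStructureOfPeriodCM`: the elliptic curve of a period `τ` is of CM type iff `τ` is
imaginary quadratic.  Theorems only: no definition, no named fact, no instance.
-/
import Summits.HodgeConjecture.CorCM.Assembly.NonCMEllipticCurveExists
import Summits.HodgeConjecture.CorCM.Geometry.WeightOneHodgeStructureOfPeriodCM
import Literature.AlgebraicGeometry.HodgeTheory.AbelianVarietyHodgeFullnessHolds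
import Literature.AlgebraicGeometry.ComplexMultiplication.EndFieldTotallyRealOrCMOfRiemann
import Literature.AlgebraicGeometry.ComplexMultiplication.ShimuraInflationBettiJunctions
import Literature.AlgebraicGeometry.HodgeTheory.WeilFamilyReachOfPeriodConstruction
import Literature.AlgebraicGeometry.HodgeTheory.HodgeClassesProductSpanCMSquare
import HarnessLib

/-!
# The elliptic curve of a period `τ` is of CM type iff `τ` is imaginary quadratic

Moonen–Zarhin 1999 (2.1), `g = 1` — «either `End⁰ X = ℚ` (Type I(1)) or `X` is an elliptic curve with CM by an
imaginary quadratic field (Type IV(1,1))» — DECIDED BY THE PERIOD, as kernel theorems about every complex abelian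
variety `A` whose `H¹_B(A)` is isomorphic in `Hod_ℚ` to the weight-one Hodge structure `V¹_τ` of a period `τ`,
`Im τ ≠ 0` (`Geometry/WeightOneHodgeStructureOfPeriod[CM]`: `V¹_τ = ofSplitting (ℂ ∙ ω) hP one_pos` on `ℚ²`,
`ω = (1, τ)`; by Riemann's theorem such `A` exist for `Im τ > 0` and are elliptic curves, `exists_ellipticCurve`):

* `isOfCMType_iff` — **`A` is of CM type (`Milne1999.IsOfCMType`) iff `τ` satisfies a rational quadratic equation
  `a τ² + b τ + c = 0`, `a ≠ 0`**; `hodgeEndTrivial_iff` — **`EllipticCurve.HodgeEndTrivial A` iff it does not**;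
  hence `isOfCMType_iff_not_hodgeEndTrivial`.  In the CM case `A` carries `ψ : A ⟶ A` with `ψ ≫ ψ = -(d • 𝟙)`,
  `d ≥ 1` (`exists_cm`); in the other case `End⁰(A) = ℚ` (gen 15, `NonCMCurve.finrank_endAlgebra_eq_one`).
* `exists_cm_ellipticCurve` — for `Im τ > 0` and `τ² + pτ + q = 0` (`p, q ∈ ℚ`) a CM elliptic curve `E` with
  `H¹_B(E) ≅ V¹_τ` exists (e.g. `H¹_B(E) ≅ V¹_{i√d}`); companion of gen 15's `NonCMCurve.exists_ellipticCurve_not_isOfCMType`.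

ROUTE (§1–§2, dimension-free).  An endomorphism `S` of `H₂ ≅ H¹_B(A)` transports to `T = f⁻¹ S f`, an endomorphism
of `H¹_B(A)`, i.e. (model independence `bettiOneHodgeStructure_eq_cast_hodge` + `isHodgeMorphismOne_of_map_F_le`) a
morphism of weight-one Hodge structures in the sense of the record; RIEMANN'S THEOREM, fullness — the tree's THEOREM
`deligneMilne1982_Thm_6_20_full_holds` — gives `u : A ⟶ A`, `k ≥ 1` with `u^* = k T`; if `S² = -r` (`r ∈ ℚ_{>0}`) then
`((N u) ≫ (N u))^* = -(k² N² r) = (-(d • 𝟙))^*` for `N = den r`, and the rational representation is faithful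
(`AbelianVariety.hom_eq_of_bettiCohomology_map_one_eq`): **an endomorphism of `H¹_B(A)` with square `-r` lifts to a
complex multiplication `ψ ≫ ψ = -(d • 𝟙)` on `A`** (`exists_cm_of_hom_sq_eq_smul`).  For `V¹_τ` with `τ² + pτ + q = 0`
the endomorphism `p · 1 + 2 M_τ` has square `p² − 4q = −4 (Im τ)² < 0`.  The converse direction is gen 15's
`NonCMCurve.not_isOfCMType` with `PeriodHodgeStructure.forall_hom_eq_smul_iff`.

HONEST SCOPE: classification statements about the curves `E` with `H¹_B(E) ≅ V¹_τ` (the isogeny class of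
`ℂ/(ℤ + τℤ)`, through Hodge theory); nothing here bears on HC_CM or on the summit.

References: [MoonenZarhin1999LowDim] B. Moonen, Yu. Zarhin, Math. Ann. 315 (1999), §2 (2.1) ·
[DeligneMilne1982Tannakian] LNM 900, II Thm. 6.20 (Riemann), p. 212 · [LangeBirkenhake1992] §1.2 Prop. 1.2.3,
Thm. 4.2.1 · [SilvermanAEC2009] VI Thm. 5.5 · [Milne1999] §2 p. 54.
-/

noncomputable section

open scoped TensorProduct
open CategoryTheory Module
open Literature.AlgebraicGeometry.Motives Literature.AlgebraicGeometry.HodgeTheory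
open Literature.AlgebraicGeometry.ComplexMultiplication
open Literature.AlgebraicGeometry.Motives.HodgeStructure

namespace Summit.HodgeConjecture.CorCM.PeriodCurve

/-! ## §1 Transport of endomorphisms along an isomorphism of Hodge structures -/

section Transport

universe u v

variable {V : Type u} [AddCommGroup V] [Module ℚ V] {W : Type v} [AddCommGroup W] [Module ℚ W] {n : ℤ}
  {H₁ : HodgeStructure V n} {H₂ : HodgeStructure W n} (f : Hom H₁ H₂) (hf : Function.Bijective f.toLinearMap)

/-- The transport `T = f⁻¹ ∘ S ∘ f` of an endomorphism `S` of `H₂` along an isomorphism `f : H₁ ≅ H₂` satisfies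
`f ∘ T = S ∘ f`. [cite: DeligneHodgeII1971, Thm. 2.3.5(iii)] -/
theorem comp_transport (S : Hom H₂ H₂) (v : V) :
    f.toLinearMap (((f.symmOfBijective hf).comp (S.comp f)).toLinearMap v) = S.toLinearMap (f.toLinearMap v) :=
  Hom.apply_symmOfBijective_apply f hf _

/-- If `S ∘ S = c • 1` then the transport `T = f⁻¹ S f` satisfies `T ∘ T = c • 1`. [folklore] -/
theorem transport_comp_transport (S : Hom H₂ H₂) {c : ℚ} (hS : S.toLinearMap ∘ₗ S.toLinearMap = c • LinearMap.id) :
    ((f.symmOfBijective hf).comp (S.comp f)).toLinearMap ∘ₗ ((f.symmOfBijective hf).comp (S.comp f)).toLinearMap =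
      c • LinearMap.id := by
  have hSS : ∀ w, S.toLinearMap (S.toLinearMap w) = c • w := fun w => by
    simpa using LinearMap.congr_fun hS w
  refine LinearMap.ext fun v => ?_
  change (f.symmOfBijective hf).toLinearMap (S.toLinearMap (f.toLinearMap ((f.symmOfBijective hf).toLinearMap
    (S.toLinearMap (f.toLinearMap v))))) = c • v
  rw [Hom.apply_symmOfBijective_apply, hSS, map_smul, Hom.symmOfBijective_apply_apply]

/-- The transport of a non-scalar endomorphism is non-scalar. [folklore] -/
theorem transport_ne_smul (S : Hom H₂ H₂) (hS : ∀ r : ℚ, S.toLinearMap ≠ r • LinearMap.id) (r : ℚ) :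
    ((f.symmOfBijective hf).comp (S.comp f)).toLinearMap ≠ r • LinearMap.id := by
  intro h
  apply hS r
  refine LinearMap.ext fun w => ?_
  have key := comp_transport f hf S ((f.symmOfBijective hf).toLinearMap w)
  rw [Hom.apply_symmOfBijective_apply, h, LinearMap.smul_apply, LinearMap.id_apply, map_smul,
    Hom.apply_symmOfBijective_apply] at key
  rw [LinearMap.smul_apply, LinearMap.id_apply, key]

end Transport

/-! ## §2 Endomorphisms of `H¹_B(A)` with negative rational square lift to complex multiplications on `A` -/

section AbelianVariety

variable {A : AbelianVariety ℂ} {B : HodgeModel A.dim A.X} {hB : B.IsHodgeSymmetric}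

/-- An endomorphism of `H¹_B(A)` (in any Hodge-symmetric model) is a morphism of weight-one rational Hodge
structures in the sense of the fullness record (`IsHodgeMorphismOne`): model independence
(`bettiOneHodgeStructure_eq_cast_hodge`) and `isHodgeMorphismOne_of_map_F_le`.
[cite: VoisinHodgeI2002, §7.1.1 Def. 7.4 and §7.3.2] [cite: DeligneMilne1982Tannakian, §6 (Hod_ℚ)] -/
theorem isHodgeMorphismOne_of_hom (T : Hom (bettiOneHodgeStructure A B hB) (bettiOneHodgeStructure A B hB)) :
    IsHodgeMorphismOne A A T.toLinearMap := by
  have e := bettiOneHodgeStructure_eq_cast_hodge exists_isReal_hodgeModel_holds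
    hodgePQ_independent_of_hodgeModel_holds A B hB AbelianVariety.isSmoothProjective_holds
  refine isHodgeMorphismOne_of_map_F_le exists_isReal_hodgeModel_holds hodgePQ_independent_of_hodgeModel_holds
    T.toLinearMap fun p => ?_
  have key : ∀ ψ : bettiCohomology A.X 1 →ₗ[ℚ] bettiCohomology A.X 1,
      ((bettiOneHodgeStructure A B hB).F p).map (ψ.baseChange ℂ) ≤ (bettiOneHodgeStructure A B hB).F p →
        (((BettiUniverse.hodge exists_isReal_hodgeModel_holds (AbelianVariety.isSmoothProjective_holds (A := A))
            1).cast Nat.cast_one).F p).map (ψ.baseChange ℂ) ≤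
          ((BettiUniverse.hodge exists_isReal_hodgeModel_holds (AbelianVariety.isSmoothProjective_holds (A := A))
            1).cast Nat.cast_one).F p :=
    fun ψ hψ => e ▸ hψ
  have h := key T.toLinearMap (T.map_F_le p)
  rwa [cast_F] at h

/-- `(-u)^* = -u^*` on `H¹(−; ℚ)` (additivity, `bettiCohomology_map_add_one`). [folklore] -/
theorem bettiCohomology_map_neg_one {A' B' : AbelianVariety ℂ} (u : A' ⟶ B') :
    bettiCohomology.map (-u).hom.hom.hom 1 = -bettiCohomology.map u.hom.hom.hom 1 := by
  have h := bettiCohomology_map_add_one u (-u)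
  rw [add_neg_cancel, bettiCohomology_map_zero_one] at h
  exact (neg_eq_of_add_eq_zero_right h.symm).symm

/-- **Riemann's theorem (fullness), applied**: every endomorphism `T` of `H¹_B(A)` is `k⁻¹ u^*` for an
endomorphism `u` of `A` and some `k ≥ 1` (the tree's theorem `deligneMilne1982_Thm_6_20_full_holds`).
[cite: DeligneMilne1982Tannakian, art. II §6 Thm. 6.20 (Riemann), LNM 900 p. 212] -/
theorem exists_map_eq_smul (T : Hom (bettiOneHodgeStructure A B hB) (bettiOneHodgeStructure A B hB)) :
    ∃ (u : A ⟶ A) (k : ℕ), 0 < k ∧ (bettiCohomology.map u.hom.hom.hom 1).hom = (k : ℚ) • T.toLinearMap := by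
  obtain ⟨u, k, hk, hu⟩ := deligneMilne1982_Thm_6_20_full_holds A A T.toLinearMap
    (nonempty_hodgeModel_holds AbelianVariety.isSmoothProjective_holds) (isHodgeMorphismOne_of_hom T)
  exact ⟨u, k, hk, LinearMap.ext fun v => by rw [LinearMap.smul_apply, Nat.cast_smul_eq_nsmul]; exact hu v⟩

/-- **An endomorphism of `H¹_B(A)` with negative rational square lifts to a complex multiplication on `A`**:
if `T ∘ T = c • 1` with `c < 0` then there are `ψ : A ⟶ A` and `d ≥ 1` with `ψ ≫ ψ = -(d • 𝟙 A)`.  With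
`u^* = k T` (fullness), `r = -c`, `N = den r`: `((N u) ≫ (N u))^* = N² k² T² = -(k² N (N r)) = (-(d • 𝟙))^*`,
`d = k² N num r`, and the rational representation is faithful.
[cite: DeligneMilne1982Tannakian, art. II §6 Thm. 6.20 (Riemann), LNM 900 p. 212]
[cite: LangeBirkenhake1992, §1.1 (ρ_r injective) and §1.2 Prop. 1.2.3] -/
theorem exists_cm_of_hom_sq_eq_smul (T : Hom (bettiOneHodgeStructure A B hB) (bettiOneHodgeStructure A B hB))
    {c : ℚ} (hc : c < 0) (hT : T.toLinearMap ∘ₗ T.toLinearMap = c • LinearMap.id) :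
    ∃ (ψ : A ⟶ A) (d : ℕ), 0 < d ∧ ψ ≫ ψ = -(d • 𝟙 A) := by
  obtain ⟨u, k, hk, hu⟩ := exists_map_eq_smul T
  have hTT : ∀ v, T.toLinearMap (T.toLinearMap v) = c • v := fun v => by
    simpa using LinearMap.congr_fun hT v
  set r : ℚ := -c with hr_def
  have hnum : 0 < r.num := Rat.num_pos.2 (neg_pos.2 hc)
  have hNr : (r.den : ℚ) * r = (r.num.natAbs : ℕ) := by
    have h1 : r * r.den = r.num := Rat.mul_den_eq_num r
    have h2 : ((r.num.natAbs : ℕ) : ℤ) = r.num := Int.natAbs_of_nonneg hnum.le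
    rw [mul_comm, h1, ← Int.cast_natCast, h2]
  refine ⟨r.den • u, k * k * (r.den * r.num.natAbs),
    Nat.mul_pos (Nat.mul_pos hk hk) (Nat.mul_pos r.den_pos (Int.natAbs_pos.2 hnum.ne')),
    AbelianVariety.hom_eq_of_bettiCohomology_map_one_eq (ModuleCat.hom_ext ?_)⟩
  rw [bettiCohomology_map_comp_hom, bettiCohomology_map_nsmul_one, bettiCohomology_map_neg_one,
    bettiCohomology_map_nsmul_id_one, ModuleCat.hom_comp, ModuleCat.hom_nsmul, ModuleCat.hom_neg,
    ModuleCat.hom_nsmul, ModuleCat.hom_id, hu]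
  refine LinearMap.ext fun v => ?_
  simp only [LinearMap.comp_apply, LinearMap.smul_apply, LinearMap.neg_apply, LinearMap.id_apply,
    ← Nat.cast_smul_eq_nsmul ℚ, map_smul, hTT, smul_smul, Nat.cast_mul]
  rw [← hNr, hr_def]
  module

end AbelianVariety

/-! ## §3 Abelian varieties with `H¹_B(A) ≅ V¹_τ`: complex multiplication iff `τ` is quadratic -/

section Period

variable {τ : ℂ} {ω : ℂ ⊗[ℚ] (Fin 2 → ℚ)} (h0 : TensorProduct.piScalarRight ℚ ℂ ℂ (Fin 2) ω 0 = 1)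
  (h1 : TensorProduct.piScalarRight ℚ ℂ ℂ (Fin 2) ω 1 = τ) (hP : IsCompl (ℂ ∙ ω) (complexConj (ℂ ∙ ω)))
  {A : AbelianVariety ℂ} {B : HodgeModel A.dim A.X} {hB : B.IsHodgeSymmetric}
  (f : Hom (bettiOneHodgeStructure A B hB) (ofSplitting (ℂ ∙ ω) hP one_pos : HodgeStructure (Fin 2 → ℚ) 1))
  (hf : Function.Bijective f.toLinearMap)

include f hf in
/-- An abelian variety with `H¹_B(A) ≅ V¹_τ` is an elliptic curve: `2 dim A = dim_ℚ ℚ² = 2`.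
[cite: LangeBirkenhake1992, §1.1 Lemma 1.1.17] -/
theorem dim_eq_one : A.dim = 1 := by
  have h := NonCMCurve.two_mul_dim_eq_finrank f hf
  rw [Module.finrank_fin_fun] at h
  omega

/-- A rational quadratic equation `τ² + pτ + q = 0` with a non-real root has `4q − p² = 4 (Im τ)² > 0`. [folklore] -/
theorem four_mul_sub_sq_pos (hτ : τ.im ≠ 0) {p q : ℚ} (hτ2 : τ ^ 2 + p * τ + q = 0) : 0 < 4 * q - p ^ 2 := by
  have hre := congrArg Complex.re hτ2
  have him := congrArg Complex.im hτ2
  simp only [sq, Complex.add_re, Complex.mul_re, Complex.ratCast_re, Complex.ratCast_im, zero_mul, sub_zero,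
    Complex.zero_re, Complex.add_im, Complex.mul_im, add_zero, Complex.zero_im] at hre him
  -- him : re·im + im·re + p·im = 0, so re = -p/2
  have hre' : τ.re = -(p : ℝ) / 2 := by
    have h2 : (2 * τ.re + p) * τ.im = 0 := by linear_combination him
    rcases mul_eq_zero.1 h2 with h | h
    · linarith
    · exact absurd h hτ
  have hq : ((4 * q - p ^ 2 : ℚ) : ℝ) = 4 * τ.im ^ 2 := by
    push_cast
    rw [hre'] at hre
    linear_combination 4 * hre
  have hpos : (0 : ℝ) < 4 * τ.im ^ 2 := by positivity
  exact_mod_cast hq ▸ hpos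

variable {p q : ℚ} (hτ2 : τ ^ 2 + p * τ + q = 0)

include h0 h1 hτ2 in
/-- **For `τ² + pτ + q = 0` the Hodge structure `V¹_τ` has the endomorphism `p · 1 + 2 M_τ` of square
`p² − 4q`** (as `M_τ² + p M_τ + q = 0`). [cite: MoonenZarhin1999LowDim, §2 (2.1) (g = 1), Type IV(1,1)] -/
theorem exists_hom_sq_eq :
    ∃ S : Hom (ofSplitting (ℂ ∙ ω) hP one_pos : HodgeStructure (Fin 2 → ℚ) 1) (ofSplitting (ℂ ∙ ω) hP one_pos),
      S.toLinearMap ∘ₗ S.toLinearMap = (p ^ 2 - 4 * q) • LinearMap.id := by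
  refine ⟨⟨p • LinearMap.id + (2 : ℚ) • Matrix.toLin' !![(0 : ℚ), 1; -q, -p],
    PeriodHodgeStructure.map_F_le_smul_add_smul_cmMap h0 h1 hP hτ2 p 2⟩, ?_⟩
  have hC := PeriodHodgeStructure.cmMap_comp_cmMap p q
  change (p • LinearMap.id + (2 : ℚ) • Matrix.toLin' !![(0 : ℚ), 1; -q, -p]) ∘ₗ
      (p • LinearMap.id + (2 : ℚ) • Matrix.toLin' !![(0 : ℚ), 1; -q, -p]) = _
  simp only [LinearMap.add_comp, LinearMap.comp_add, LinearMap.smul_comp, LinearMap.comp_smul,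
    LinearMap.id_comp, LinearMap.comp_id, hC]
  module

include h0 h1 f hf hτ2 in
/-- **Complex multiplication from a quadratic period**: if `H¹_B(A) ≅ V¹_τ` with `τ² + pτ + q = 0`, `τ ∉ ℝ`, then
`A` has an endomorphism `ψ` with `ψ ≫ ψ = -(d • 𝟙 A)`, `d ≥ 1` (the transport of `p + 2 M_τ`, of square
`p² − 4q < 0`, lifted by Riemann's theorem). [cite: MoonenZarhin1999LowDim, §2 (2.1) (g = 1), Type IV(1,1)]
[cite: DeligneMilne1982Tannakian, art. II §6 Thm. 6.20 (Riemann), LNM 900 p. 212] -/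
theorem exists_cm (hτ : τ.im ≠ 0) : ∃ (ψ : A ⟶ A) (d : ℕ), 0 < d ∧ ψ ≫ ψ = -(d • 𝟙 A) := by
  obtain ⟨S, hS⟩ := exists_hom_sq_eq h0 h1 hP hτ2
  have hneg : p ^ 2 - 4 * q < 0 := by linarith [four_mul_sub_sq_pos hτ hτ2]
  exact exists_cm_of_hom_sq_eq_smul _ hneg (transport_comp_transport f hf S hS)

include h0 h1 f hf hτ2 in
/-- **`H¹_B(A) ≅ V¹_τ` with `τ` quadratic (`τ ∉ ℝ`) ⟹ `A` is of CM type** (`Milne1999.IsOfCMType`; `ℚ[ψ] ≅ ℚ(√-d)`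
has degree `2 = 2 dim A`, `isOfCMType_of_cmCurve`). [cite: MoonenZarhin1999LowDim, §2 (2.1) (g = 1), Type IV(1,1)]
[cite: Milne1999, §2 p. 54] -/
theorem isOfCMType (hτ : τ.im ≠ 0) : Literature.AlgebraicGeometry.Milne1999.IsOfCMType A := by
  obtain ⟨ψ, d, hd, hψ⟩ := exists_cm h0 h1 hP f hf hτ2 hτ
  exact isOfCMType_of_cmCurve (dim_eq_one hP f hf) hd hψ

include h0 h1 f hf hτ2 in
/-- **`H¹_B(A) ≅ V¹_τ` with `τ` quadratic (`τ ∉ ℝ`) ⟹ `A` has complex multiplication in the Hodge-theoretic sense**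
(`¬ EllipticCurve.HodgeEndTrivial A`, by `EllipticCurve.not_hodgeEndTrivial_of_cm`).
[cite: MoonenZarhin1999LowDim, §2 (2.1) (g = 1), Type IV(1,1)] -/
theorem not_hodgeEndTrivial (hτ : τ.im ≠ 0) : ¬ EllipticCurve.HodgeEndTrivial A := by
  obtain ⟨ψ, d, hd, hψ⟩ := exists_cm h0 h1 hP f hf hτ2 hτ
  exact EllipticCurve.not_hodgeEndTrivial_of_cm (dim_eq_one hP f hf) ψ hd hψ

omit hτ2 in
include h0 h1 f hf in
/-- **THE DICHOTOMY ON THE PERIOD (CM type).**  For every complex abelian variety `A` with `H¹_B(A) ≅ V¹_τ`,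
`τ ∉ ℝ`: **`A` is of CM type iff `τ` satisfies a rational quadratic equation `a τ² + b τ + c = 0` with `a ≠ 0`**
(Moonen–Zarhin (2.1), `g = 1`: Type IV(1,1) iff `[ℚ(τ):ℚ] = 2`; the torus `ℂ/(ℤ + τℤ)` has complex multiplication
iff `τ` is imaginary quadratic).  `←`: `isOfCMType`; `→`: otherwise `End(V¹_τ) = ℚ`
(`PeriodHodgeStructure.forall_hom_eq_smul_iff`) and gen 15's `NonCMCurve.not_isOfCMType`.
[cite: MoonenZarhin1999LowDim, §2 (2.1) (g = 1)] [cite: SilvermanAEC2009, VI Thm. 5.5]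
[cite: DeligneMilne1982Tannakian, art. II §6 Thm. 6.20 (Riemann), LNM 900 p. 212] -/
theorem isOfCMType_iff (hτ : τ.im ≠ 0) :
    Literature.AlgebraicGeometry.Milne1999.IsOfCMType A ↔
      ∃ a b c : ℚ, a ≠ 0 ∧ (a : ℂ) * τ ^ 2 + b * τ + c = 0 := by
  constructor
  · intro hA
    by_contra hne
    have h₂ := (PeriodHodgeStructure.forall_hom_eq_smul_iff h0 h1 hP hτ).2
      ((PeriodHodgeStructure.noQuadratic_iff hτ).2 hne)
    exact NonCMCurve.not_isOfCMType f hf h₂ (by rw [dim_eq_one hP f hf]; exact one_pos) hA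
  · rintro ⟨a, b, c, ha, h⟩
    have hτ2' : τ ^ 2 + (b / a : ℚ) * τ + (c / a : ℚ) = 0 := by
      have ha' : (a : ℂ) ≠ 0 := by exact_mod_cast ha
      push_cast
      field_simp
      linear_combination h
    exact isOfCMType h0 h1 hP f hf hτ2' hτ

omit hτ2 in
include h0 h1 f hf in
/-- **THE DICHOTOMY ON THE PERIOD (Hodge endomorphisms).**  For every complex abelian variety `A` with
`H¹_B(A) ≅ V¹_τ`, `τ ∉ ℝ`: **`EllipticCurve.HodgeEndTrivial A` (every endomorphism of the Hodge structure `H¹(A)` is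
a scalar: Type I(1)) iff `τ` satisfies NO rational quadratic equation.**  `←`: gen 15's
`NonCMCurve.hodgeEndTrivial_of_hom`; `→`: `not_hodgeEndTrivial`. [cite: MoonenZarhin1999LowDim, §2 (2.1) (g = 1)]
[cite: DeligneMilne1982Tannakian, art. II §6 Thm. 6.20 (Riemann), LNM 900 p. 212] -/
theorem hodgeEndTrivial_iff (hτ : τ.im ≠ 0) :
    EllipticCurve.HodgeEndTrivial A ↔ ¬ ∃ a b c : ℚ, a ≠ 0 ∧ (a : ℂ) * τ ^ 2 + b * τ + c = 0 := by
  constructor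
  · rintro hA ⟨a, b, c, ha, h⟩
    have hτ2' : τ ^ 2 + (b / a : ℚ) * τ + (c / a : ℚ) = 0 := by
      have ha' : (a : ℂ) ≠ 0 := by exact_mod_cast ha
      push_cast
      field_simp
      linear_combination h
    exact not_hodgeEndTrivial h0 h1 hP f hf hτ2' hτ hA
  · intro hne
    exact NonCMCurve.hodgeEndTrivial_of_hom f hf ((PeriodHodgeStructure.forall_hom_eq_smul_iff h0 h1 hP hτ).2
      ((PeriodHodgeStructure.noQuadratic_iff hτ).2 hne))

omit hτ2 in
include h0 h1 f hf in
/-- **Milne's «of CM type» and Hodge-theoretic complex multiplication agree on elliptic curves with a period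
structure**: `IsOfCMType A ↔ ¬ HodgeEndTrivial A` for `H¹_B(A) ≅ V¹_τ`, `τ ∉ ℝ` (both sides are «`τ` is quadratic»).
[cite: MoonenZarhin1999LowDim, §2 (2.1) (g = 1)] [cite: Milne1999, §2 p. 54] -/
theorem isOfCMType_iff_not_hodgeEndTrivial (hτ : τ.im ≠ 0) :
    Literature.AlgebraicGeometry.Milne1999.IsOfCMType A ↔ ¬ EllipticCurve.HodgeEndTrivial A := by
  rw [isOfCMType_iff h0 h1 hP f hf hτ, hodgeEndTrivial_iff h0 h1 hP f hf hτ, not_not]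

include h0 h1 in
/-- **Riemann's theorem (essential image), applied: for `Im τ > 0` an abelian variety `A` with `H¹_B(A) ≅ V¹_τ`
exists** (`V¹_τ` is polarisable and effective, gen 15; `deligneMilne1982_Thm_6_20_essImage_holds`), and it is an
elliptic curve (`dim_eq_one`). [cite: DeligneMilne1982Tannakian, art. II §6 Thm. 6.20 (Riemann), LNM 900 p. 212]
[cite: LangeBirkenhake1992, Thm. 4.2.1] -/
theorem exists_ellipticCurve (hτ' : 0 < τ.im) :
    ∃ (E : AbelianVariety ℂ) (B : HodgeModel E.dim E.X) (hB : B.IsHodgeSymmetric)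
      (f : Hom (bettiOneHodgeStructure E B hB) (ofSplitting (ℂ ∙ ω) hP one_pos : HodgeStructure (Fin 2 → ℚ) 1)),
      Function.Bijective f.toLinearMap ∧ E.dim = 1 := by
  obtain ⟨E, B, hB, f, hf⟩ := deligneMilne1982_Thm_6_20_essImage_holds _
    (PeriodHodgeStructure.isPolarizable h0 h1 hP hτ') (PeriodHodgeStructure.isEffective hP)
  exact ⟨E, B, hB, f, hf, dim_eq_one hP f hf⟩

end Period

/-! ## §4 Exports at the level of `τ` -/

/-- Coordinates `(1, τ)` of the standard period vector `ω_τ = 1 ⊗ e₀ + τ ⊗ e₁`. [folklore] -/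
theorem coords_periodVector (τ : ℂ) :
    TensorProduct.piScalarRight ℚ ℂ ℂ (Fin 2) ((1 : ℂ) ⊗ₜ[ℚ] (Pi.single 0 1 : Fin 2 → ℚ) + τ ⊗ₜ[ℚ] Pi.single 1 1) 0 = 1 ∧
    TensorProduct.piScalarRight ℚ ℂ ℂ (Fin 2) ((1 : ℂ) ⊗ₜ[ℚ] (Pi.single 0 1 : Fin 2 → ℚ) + τ ⊗ₜ[ℚ] Pi.single 1 1) 1 = τ := by
  constructor <;>
  · rw [map_add, Pi.add_apply, PeriodHodgeStructure.coords_tmul, PeriodHodgeStructure.coords_tmul]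
    simp

/-- **A CM elliptic curve with period `τ` exists for every non-real quadratic `τ`**: for `Im τ > 0` and
`τ² + pτ + q = 0` (`p, q ∈ ℚ`) there are a complex abelian variety `E` of dimension `1` which is of CM type, has a
complex multiplication `ψ ≫ ψ = -(d • 𝟙 E)` (`d ≥ 1`) and `¬ HodgeEndTrivial E`, and a weight-one Hodge structure
`H` on `ℚ²` with the endomorphism `M_τ = toLin' (0 1; -q -p)` (namely `V¹_τ`) together with an isomorphism
`H¹_B(E) ≅ H` in `Hod_ℚ`.  Companion of gen 15's `NonCMCurve.exists_ellipticCurve_not_isOfCMType`.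
[cite: MoonenZarhin1999LowDim, §2 (2.1) (g = 1), Type IV(1,1)] [cite: DeligneMilne1982Tannakian, art. II §6 Thm. 6.20 (Riemann), LNM 900 p. 212] -/
theorem exists_cm_ellipticCurve {τ : ℂ} (hτ' : 0 < τ.im) {p q : ℚ} (hτ2 : τ ^ 2 + p * τ + q = 0) :
    ∃ (E : AbelianVariety ℂ) (H : HodgeStructure (Fin 2 → ℚ) 1) (B : HodgeModel E.dim E.X) (hB : B.IsHodgeSymmetric)
      (f : Hom (bettiOneHodgeStructure E B hB) H),
      Function.Bijective f.toLinearMap ∧ E.dim = 1 ∧ Literature.AlgebraicGeometry.Milne1999.IsOfCMType E ∧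
        ¬ EllipticCurve.HodgeEndTrivial E ∧ (∃ (ψ : E ⟶ E) (d : ℕ), 0 < d ∧ ψ ≫ ψ = -(d • 𝟙 E)) ∧
        ∃ S : Hom H H, S.toLinearMap = Matrix.toLin' !![(0 : ℚ), 1; -q, -p] := by
  obtain ⟨h0, h1⟩ := coords_periodVector τ
  have hP := PeriodHodgeStructure.isCompl_span h0 h1 hτ'.ne'
  obtain ⟨E, B, hB, f, hf, hE⟩ := exists_ellipticCurve h0 h1 hP hτ'
  exact ⟨E, _, B, hB, f, hf, hE, isOfCMType h0 h1 hP f hf hτ2 hτ'.ne', not_hodgeEndTrivial h0 h1 hP f hf hτ2 hτ'.ne',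
    exists_cm h0 h1 hP f hf hτ2 hτ'.ne', PeriodHodgeStructure.exists_hom_eq_cmMap h0 h1 hP hτ2⟩

/-- **A CM elliptic curve with `H¹_B ≅ V¹_{i√d}` exists for every rational `d > 0`** (CM by `ℚ(√-d)`; the
isogeny class of `ℂ/(ℤ + ℤ√-d)` read through Hodge theory). [cite: MoonenZarhin1999LowDim, §2 (2.1) (g = 1), Type IV(1,1)]
[cite: SilvermanAEC2009, VI Thm. 5.5] -/
theorem exists_cm_ellipticCurve_sqrt_neg {d : ℚ} (hd : 0 < d) :
    ∃ (E : AbelianVariety ℂ) (H : HodgeStructure (Fin 2 → ℚ) 1) (B : HodgeModel E.dim E.X) (hB : B.IsHodgeSymmetric)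
      (f : Hom (bettiOneHodgeStructure E B hB) H),
      Function.Bijective f.toLinearMap ∧ E.dim = 1 ∧ Literature.AlgebraicGeometry.Milne1999.IsOfCMType E ∧
        ¬ EllipticCurve.HodgeEndTrivial E ∧ (∃ (ψ : E ⟶ E) (d' : ℕ), 0 < d' ∧ ψ ≫ ψ = -(d' • 𝟙 E)) ∧
        ∃ S : Hom H H, S.toLinearMap = Matrix.toLin' !![(0 : ℚ), 1; -d, 0] := by
  have hτ' : 0 < (Complex.I * Real.sqrt d).im := by
    simpa using Real.sqrt_pos.2 (show (0 : ℝ) < d by exact_mod_cast hd)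
  have hτ2 : (Complex.I * Real.sqrt d) ^ 2 + ((0 : ℚ) : ℂ) * (Complex.I * Real.sqrt d) + ((d : ℚ) : ℂ) = 0 := by
    have hsq : ((Real.sqrt d : ℝ) : ℂ) ^ 2 = (d : ℂ) := by
      rw [← Complex.ofReal_pow, Real.sq_sqrt (by exact_mod_cast hd.le)]
      simp
    rw [mul_pow, Complex.I_sq, hsq]
    push_cast
    ring
  obtain ⟨E, H, B, hB, f, hf, hE, hcm, hT, hψ, hS⟩ := exists_cm_ellipticCurve hτ' hτ2
  rw [neg_zero] at hS
  exact ⟨E, H, B, hB, f, hf, hE, hcm, hT, hψ, hS⟩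

/-- **The dichotomy, quantifier form.**  For every `τ` with `Im τ > 0` there is a complex elliptic curve `E` with
`H¹_B(E) ≅ V¹_τ`, and EVERY complex abelian variety `A` with `H¹_B(A) ≅ V¹_τ` is an elliptic curve which is of CM
type iff `τ` satisfies a rational quadratic equation, equivalently iff `H¹(A)` has a non-scalar Hodge endomorphism
(Moonen–Zarhin (2.1), `g = 1`, on the period; companion statement with the structure `V¹_τ` displayed:
`isOfCMType_iff`, `hodgeEndTrivial_iff`). [cite: MoonenZarhin1999LowDim, §2 (2.1) (g = 1)]
[cite: DeligneMilne1982Tannakian, art. II §6 Thm. 6.20 (Riemann), LNM 900 p. 212] [cite: SilvermanAEC2009, VI Thm. 5.5] -/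
theorem dichotomy_of_period {τ : ℂ} (hτ' : 0 < τ.im) :
    ∃ H : HodgeStructure (Fin 2 → ℚ) 1,
      (H.F 1 = ℂ ∙ ((1 : ℂ) ⊗ₜ[ℚ] (Pi.single 0 1 : Fin 2 → ℚ) + τ ⊗ₜ[ℚ] Pi.single 1 1)) ∧
      (∃ (E : AbelianVariety ℂ) (B : HodgeModel E.dim E.X) (hB : B.IsHodgeSymmetric)
        (f : Hom (bettiOneHodgeStructure E B hB) H), Function.Bijective f.toLinearMap) ∧
      ∀ (A : AbelianVariety ℂ) (B : HodgeModel A.dim A.X) (hB : B.IsHodgeSymmetric)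
        (f : Hom (bettiOneHodgeStructure A B hB) H), Function.Bijective f.toLinearMap →
          A.dim = 1 ∧
          (Literature.AlgebraicGeometry.Milne1999.IsOfCMType A ↔
              ∃ a b c : ℚ, a ≠ 0 ∧ (a : ℂ) * τ ^ 2 + b * τ + c = 0) ∧
          (EllipticCurve.HodgeEndTrivial A ↔ ¬ ∃ a b c : ℚ, a ≠ 0 ∧ (a : ℂ) * τ ^ 2 + b * τ + c = 0) := by
  obtain ⟨h0, h1⟩ := coords_periodVector τ
  have hP := PeriodHodgeStructure.isCompl_span h0 h1 hτ'.ne'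
  obtain ⟨E, B, hB, f, hf, -⟩ := exists_ellipticCurve h0 h1 hP hτ'
  exact ⟨_, PeriodHodgeStructure.F_one hP, ⟨E, B, hB, f, hf⟩, fun A B' hB' g hg =>
    ⟨dim_eq_one hP g hg, isOfCMType_iff h0 h1 hP g hg hτ'.ne', hodgeEndTrivial_iff h0 h1 hP g hg hτ'.ne'⟩⟩

end Summit.HodgeConjecture.CorCM.PeriodCurve

end
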